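import Mathlib
import Summits.NavierStokesRegularity.NavierStokesRegularity.Theorems.LerayQuarterDissipationFiniteDissipationLiouvilleEveryInstantMixed
import Summits.NavierStokesRegularity.NavierStokesRegularity.Theorems.LerayQuarterDissipationFiniteDissipationLiouvilleThresholdOneDss
import Summits.NavierStokesRegularity.NavierStokesRegularity.Theorems.LerayQuarterDissipationFiniteDissipationLiouvilleHardness
import HarnessLib

/-!
# Crux `FiniteDissipationLiouville` (stmt-NavierStokesRegularity-22144): the every-instant floors as
# LAW-FREE statements and on the DSS WALL — Bradshaw–Tsai OP 5.1 holds, every factor, for the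
# Type-I DSS profiles whose dimensionless enstrophy dips below the explicit threshold at ONE instant

Theorems file of route `LerayQuarterDissipation` (lead prover g17; `--supports` the crux; corollaries
of `…EveryInstant` / `…EveryInstantMixed` with the route's hardness bridge `…Hardness` and the DSS
leaf `…ThresholdOneDss`). Navier–Stokes regularity is NOT proved by anything here; no summit is.

The route's wall `Literature.Analysis.FluidPDE.TypeIDSSLiouville c` (a backward `c`-DSS ancient mild
solution with a Type-I envelope vanishes; OPEN for factors away from `1`, NECESSARY for the crux). Its
KNSS-gauge members lie in the stratum (`Hardness.exists_dissipationLaw_of_hasTypeIDecay`), where the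
EVERY-INSTANT FLOOR of this generation applies: the global similarity enstrophy
`Z(s) = ∫‖Ω(s)‖² = √(−t)∫‖curl V(t)‖²dx` of a singular member never dips below `K_S⁶Z² = 64/27`
(`…EveryInstant`), nor into the mixed lens (`…EveryInstantMixed`). Hence:

* `not_singular_of_typeI_envelope_of_subthreshold_instant` — (no self-similarity) an enveloped
  Type-I ancient mild field with `(√Z(s₀)(√K_S)³)⁴ < 64/27` at ONE instant is regular at the apex;
* `eq_zero_of_pastDss_of_subthreshold_instant` — a member of `𝒟_{C,K}`, discretely self-similar on
  the past with ANY factor `c > 1`, with ONE sub-threshold instant vanishes identically;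
* **`eq_zero_of_typeI_dss_of_subthreshold_instant`** — **LAW-FREE: a Type-I ancient mild field with a
  Type-I envelope, past-DSS with any factor, whose dimensionless enstrophy is below the explicit
  threshold at ONE instant of its period, vanishes identically** — Bradshaw–Tsai OP 5.1 on that
  sub-class, every factor (the all-time rung needed `sup_t`);
* `eq_zero_of_typeI_dss_le_one_of_instant_lt_four` — the same at Type-I constant `C ≤ 1` with the
  threshold `4` (the lens-shaped floor).

HONEST FRAMING. Restrictions of the catalogued open problem to explicit sub-classes (Mathlib's
non-sharp `K_S`); the wall for profiles whose dimensionless enstrophy stays above the threshold at all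
instants remains OPEN; nothing here bears on Navier–Stokes regularity or blow-up.

References: Bradshaw–Tsai, Comm. PDE 42 (2017) OP 5.1; Chae–Wolf, arXiv:1610.09464;
Koch–Nadirashvili–Seregin–Šverák, Acta Math. 203 (2009); Tsai, GSM 192, Conj. 8.8–8.9.
-/

noncomputable section

set_option linter.dupNamespace false

namespace Summit.NavierStokesRegularity.NavierStokesRegularity.Theorems.FiniteDissipationLiouville.EveryInstantWall

open MeasureTheory Set Filter Topology Metric InnerProductSpace Function Real
open scoped RealInnerProductSpace ContDiff ENNReal Laplacian
open Literature.Analysis Literature.Analysis.FluidPDE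
open Summit.NavierStokesRegularity.NavierStokesRegularity.Theorems
open Summit.NavierStokesRegularity.NavierStokesRegularity.Theorems.FiniteDissipationLiouville
open Summit.NavierStokesRegularity.NavierStokesRegularity.Theorems.FiniteDissipationLiouville.Trapping
open Summit.NavierStokesRegularity.NavierStokesRegularity.Theorems.FiniteDissipationLiouville.EveryInstant
open Summit.NavierStokesRegularity.NavierStokesRegularity.Theorems.FiniteDissipationLiouville.EveryInstantMixed

variable {C C₀ : ℝ} {V : ℝ → EuclideanSpace ℝ (Fin 3) → EuclideanSpace ℝ (Fin 3)}

/-- **One sub-threshold instant forces regularity, LAW-FREE form.** A Type-I ancient mild field in the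
KNSS gauge with a Type-I envelope `HasTypeIDecay C₀ V` whose global similarity enstrophy satisfies
`(√Z(s₀)(√K_S)³)⁴ < 64/27` at ONE instant `s₀` is bounded on some backward cylinder at the origin
(the envelope gives the quarter-rate law; `…EveryInstant.not_singular_of_subthreshold_instant`).
[folklore energy method] -/
theorem not_singular_of_typeI_envelope_of_subthreshold_instant (hV : IsTypeIAncientMild C V)
    (hdec : HasTypeIDecay C₀ V) {s₀ : ℝ}
    (h0 : (Real.sqrt (∫ y, ‖lerayVorticity V s₀ y‖ ^ 2) * Real.sqrt (SNormLESNormFDerivOfEqConst (EuclideanSpace ℝ (Fin 3))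
        (volume : Measure (EuclideanSpace ℝ (Fin 3))) 2 : ℝ) ^ 3) ^ 4 < 64 / 27) :
    ¬ (∀ r > 0, ∀ M : ℝ, ∃ t ∈ Set.Ioo (-(r ^ 2)) (0 : ℝ),
        ∃ x ∈ Metric.ball (0 : EuclideanSpace ℝ (Fin 3)) r, M < ‖V t x‖) := by
  obtain ⟨K', hlaw⟩ := Hardness.exists_dissipationLaw_of_hasTypeIDecay hV hdec
  exact not_singular_of_subthreshold_instant hV hlaw h0

/-- **The DSS wall on the stratum below one sub-threshold instant, EVERY factor.** A member of
`𝒟_{C,K}` which is discretely self-similar on the past with some factor `c > 1` and whose global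
similarity enstrophy is below the explicit threshold at ONE instant vanishes identically (regular at
the apex by `…EveryInstant`; regular past-DSS members vanish, `…ThresholdOneDss`).
[folklore energy method] -/
theorem eq_zero_of_pastDss_of_subthreshold_instant {K c : ℝ} (hV : IsTypeIAncientMild C V)
    (hK : ∀ t : ℝ, t < 0 → ∫⁻ x, ‖fderiv ℝ (V t) x‖ₑ ^ 2 ≤ ENNReal.ofReal (K / Real.sqrt (-t)))
    (hc : 1 < c) (hdss : ∀ t : ℝ, t < 0 → ∀ x, c • V (c ^ 2 * t) (c • x) = V t x) {s₀ : ℝ}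
    (h0 : (Real.sqrt (∫ y, ‖lerayVorticity V s₀ y‖ ^ 2) * Real.sqrt (SNormLESNormFDerivOfEqConst (EuclideanSpace ℝ (Fin 3))
        (volume : Measure (EuclideanSpace ℝ (Fin 3))) 2 : ℝ) ^ 3) ^ 4 < 64 / 27) :
    ∀ t < 0, ∀ x, V t x = 0 :=
  ThresholdOne.eq_zero_of_pastDss_of_not_singular hV hK hc hdss
    (not_singular_of_subthreshold_instant hV hK h0)

/-- **Bradshaw–Tsai OP 5.1 on the sub-class «dimensionless enstrophy below the threshold at one
instant», every factor — LAW-FREE.** A Type-I ancient mild field `V` (KNSS gauge, constant `C`) with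
a Type-I envelope `HasTypeIDecay C₀ V`, discretely self-similar on the past with some factor `c > 1`,
with `(√Z(s₀)(√K_S)³)⁴ < 64/27` at ONE instant `s₀` (`Z(s) = √(−t)∫‖curl V(t)‖²dx`), vanishes
identically on `t < 0`. [folklore energy method] -/
theorem eq_zero_of_typeI_dss_of_subthreshold_instant (hV : IsTypeIAncientMild C V)
    (hdec : HasTypeIDecay C₀ V) {c : ℝ} (hc : 1 < c)
    (hdss : ∀ t : ℝ, t < 0 → ∀ x, c • V (c ^ 2 * t) (c • x) = V t x) {s₀ : ℝ}
    (h0 : (Real.sqrt (∫ y, ‖lerayVorticity V s₀ y‖ ^ 2) * Real.sqrt (SNormLESNormFDerivOfEqConst (EuclideanSpace ℝ (Fin 3))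
        (volume : Measure (EuclideanSpace ℝ (Fin 3))) 2 : ℝ) ^ 3) ^ 4 < 64 / 27) :
    ∀ t < 0, ∀ x, V t x = 0 := by
  obtain ⟨K', hlaw⟩ := Hardness.exists_dissipationLaw_of_hasTypeIDecay hV hdec
  exact eq_zero_of_pastDss_of_subthreshold_instant hV hlaw hc hdss h0

/-- The same for a field discretely self-similar at all times (`IsDiscretelySelfSimilar c V`).
[folklore energy method] -/
theorem eq_zero_of_typeI_dss_of_subthreshold_instant' (hV : IsTypeIAncientMild C V)
    (hdec : HasTypeIDecay C₀ V) {c : ℝ} (hc : 1 < c) (hdss : IsDiscretelySelfSimilar c V) {s₀ : ℝ}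
    (h0 : (Real.sqrt (∫ y, ‖lerayVorticity V s₀ y‖ ^ 2) * Real.sqrt (SNormLESNormFDerivOfEqConst (EuclideanSpace ℝ (Fin 3))
        (volume : Measure (EuclideanSpace ℝ (Fin 3))) 2 : ℝ) ^ 3) ^ 4 < 64 / 27) :
    ∀ t < 0, ∀ x, V t x = 0 := by
  refine eq_zero_of_typeI_dss_of_subthreshold_instant hV hdec hc (fun t _ x => ?_) h0
  have h := congrFun (congrFun hdss t) x
  rwa [nsRescale_apply] at h

/-- **Physical form**: an enveloped Type-I field, past-DSS with any factor, whose vorticity at ONE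
instant `t₀ < 0` satisfies `(√(√(−t₀)∫‖curl V(t₀)‖²dx)·(√K_S)³)⁴ < 64/27` — finite physical enstrophy
assumed at that instant — vanishes identically. [folklore energy method] -/
theorem eq_zero_of_typeI_dss_of_vorticity_instant (hV : IsTypeIAncientMild C V)
    (hdec : HasTypeIDecay C₀ V) {c : ℝ} (hc : 1 < c)
    (hdss : ∀ t : ℝ, t < 0 → ∀ x, c • V (c ^ 2 * t) (c • x) = V t x) {t₀ : ℝ} (ht₀ : t₀ < 0)
    (h0 : (Real.sqrt (Real.sqrt (-t₀) * ∫ x, ‖curl (V t₀) x‖ ^ 2) * Real.sqrt (SNormLESNormFDerivOfEqConst (EuclideanSpace ℝ (Fin 3))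
        (volume : Measure (EuclideanSpace ℝ (Fin 3))) 2 : ℝ) ^ 3) ^ 4 <
      64 / 27) :
    ∀ t < 0, ∀ x, V t x = 0 := by
  set s : ℝ := -Real.log (-t₀) with hs
  have hts : -Real.exp (-s) = t₀ := by rw [hs, neg_neg, Real.exp_log (neg_pos.2 ht₀), neg_neg]
  have hsq : Real.exp (-s / 2) = Real.sqrt (-t₀) := by
    rw [← sqrt_exp_neg, ← neg_neg (Real.exp _), hts]
  refine eq_zero_of_typeI_dss_of_subthreshold_instant hV hdec hc hdss (s₀ := s) ?_
  rwa [integral_sq_norm_lerayVorticity_eq, hts, hsq]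

/-- **At Type-I constant `C ≤ 1` the threshold of the one-instant DSS exclusion is `4`** (the
lens-shaped floor `…EveryInstantMixed.vorticity_floor_four_of_singular_of_typeI_le_one`): an enveloped
Type-I field with `C ≤ 1`, past-DSS with any factor, with
`(√(√(−t₀)∫‖curl V(t₀)‖²dx)·(√K_S)³)⁴ < 4` at ONE instant `t₀ < 0`, vanishes identically.
[folklore energy method] -/
theorem eq_zero_of_typeI_dss_le_one_of_instant_lt_four (hV : IsTypeIAncientMild C V) (hC1 : C ≤ 1)
    (hdec : HasTypeIDecay C₀ V) {c : ℝ} (hc : 1 < c)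
    (hdss : ∀ t : ℝ, t < 0 → ∀ x, c • V (c ^ 2 * t) (c • x) = V t x) {t₀ : ℝ} (ht₀ : t₀ < 0)
    (h0 : (Real.sqrt (Real.sqrt (-t₀) * ∫ x, ‖curl (V t₀) x‖ ^ 2) * Real.sqrt (SNormLESNormFDerivOfEqConst (EuclideanSpace ℝ (Fin 3))
        (volume : Measure (EuclideanSpace ℝ (Fin 3))) 2 : ℝ) ^ 3) ^ 4 < 4) :
    ∀ t < 0, ∀ x, V t x = 0 := by
  obtain ⟨K', hlaw⟩ := Hardness.exists_dissipationLaw_of_hasTypeIDecay hV hdec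
  refine ThresholdOne.eq_zero_of_pastDss_of_not_singular hV hlaw hc hdss fun hsing => ?_
  have h := vorticity_floor_four_of_singular_of_typeI_le_one hV hC1 hlaw hsing ht₀
  linarith

end Summit.NavierStokesRegularity.NavierStokesRegularity.Theorems.FiniteDissipationLiouville.EveryInstantWall

end
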